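import Mathlib
import Summits.NavierStokesRegularity.NavierStokesRegularity.Theorems.TrappingWindowRungThreeTrappingBootstrap
import Summits.NavierStokesRegularity.NavierStokesRegularity.Theses.TrappingWindowRungThree
import Summits.NavierStokesRegularity.NavierStokesRegularity.Theses.ExactWindowRungThree
import HarnessLib

/-!
# `ExactWindowRungThree.TransferBootstrap` from `TrappingWindowRungThree.ShadowingTransfer`
  (helper for item stmt-NavierStokesRegularity-22416, support S1′ of route `ExactWindowRungThree`)

The ideator's transfer plan for the two TL-M3 window routes (evidence TRANSFER-PLAN.md on items
22916 / 22616 / 21749 / 22416) reads `TransferBootstrap = ShadowingTransfer ∘ TrappingBootstrap`.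
Now that `TrappingBootstrap` (item 21749) is a tree theorem
(`trappingWindowRungThree_trappingBootstrap_proof`), this file records the composition in the
kernel: the crux `ExactWindowRungThree.ExactFlowCertificate` (item 22916) is, character for
character, the hypothesis of `TrappingWindowRungThree.ShadowingTransfer` (item 22924), and
`ExactWindowRungThree.TailEnvelopes` is, character for character,
`TrappingWindowRungThree.TailEnvelopes` (item 21748, shared); so the load-bearing support
`TransferBootstrap` of LINE 2 REDUCES to the single analysis item `ShadowingTransfer`
(finite-dimensional shadowing in the certified tube), with no further glue.

HONEST FRAMING: pure composition (definitional unfolding) over Tao-type MODEL lattice statements;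
`ShadowingTransfer` is a HYPOTHESIS here (item 22924 is open), nothing about the Navier–Stokes
equations is concluded, the routes' leaf `TaoLadderRungThree.Target` (TL-M3) is not the summit
Statement, and NS regularity is NOT proved by anything in this file.
-/

noncomputable section

-- the sub-problem namespace repeats the summit name by design (D-0017)
set_option linter.dupNamespace false

namespace Summit.NavierStokesRegularity.NavierStokesRegularity.Theorems

/-- **`ShadowingTransfer → TransferBootstrap`** (serves item stmt-NavierStokesRegularity-22416 of
route `ExactWindowRungThree`; conditional on item stmt-NavierStokesRegularity-22924 of route
`TrappingWindowRungThree`, taken as the hypothesis `hS`). Given the shadowing transfer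
(exact-flow certificate ⇒ inclusion trapping certificate), the exact-flow certificate and the tail
envelopes give the `RobustStep` package at `ε₀ = 1` by `trappingWindowRungThree_trappingBootstrap_proof`;
the two routes' `ExactFlowCertificate` / `TailEnvelopes` texts agree verbatim, so this is
definitional unfolding. MODEL lattice statement; nothing about Navier–Stokes is concluded.
[cite: Tao2016AveragedNS, §6.4 Prop. 6.5 (statement shape of the robust step)] -/
theorem exactWindowRungThree_transferBootstrap_of_shadowingTransfer
    (hS : Summit.NavierStokesRegularity.NavierStokesRegularity.Theses.TrappingWindowRungThree.ShadowingTransfer) :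
    Summit.NavierStokesRegularity.NavierStokesRegularity.Theses.ExactWindowRungThree.TransferBootstrap := by
  unfold Summit.NavierStokesRegularity.NavierStokesRegularity.Theses.ExactWindowRungThree.TransferBootstrap
  unfold Summit.NavierStokesRegularity.NavierStokesRegularity.Theses.TrappingWindowRungThree.ShadowingTransfer
    at hS
  intro hE hK2
  unfold Summit.NavierStokesRegularity.NavierStokesRegularity.Theses.ExactWindowRungThree.ExactFlowCertificate
    at hE
  unfold Summit.NavierStokesRegularity.NavierStokesRegularity.Theses.ExactWindowRungThree.TailEnvelopes
    at hK2
  have h := trappingWindowRungThree_trappingBootstrap_proof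
  unfold Summit.NavierStokesRegularity.NavierStokesRegularity.Theses.TrappingWindowRungThree.TrappingBootstrap
    Summit.NavierStokesRegularity.NavierStokesRegularity.Theses.TrappingWindowRungThree.TailEnvelopes at h
  exact h (hS hE) hK2

end Summit.NavierStokesRegularity.NavierStokesRegularity.Theorems

end
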